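import Mathlib.LinearAlgebra.Matrix.Determinant.Basic
import Mathlib.LinearAlgebra.Matrix.NonsingularInverse
import Mathlib.Data.Matrix.Block
import Mathlib.RingTheory.Localization.FractionRing
import Mathlib.Tactic.LinearCombination
import HarnessLib

/-!
# JACOBI'S COMPLEMENTARY-MINOR IDENTITY (ideal form) and the duality of minors for a matrix with `W * W = c • 1`
# (kernel piece (J) of LEMMA N — the `e = 1` Frobenius norm ideal of the specimen P2d4C; crux `FInjectiveMacaulayfication`
# stmt-ResolutionOfSingularities-15315, chain w45a, F-centre census Tier-1; res-L1-w45a-plan-1 06:03:10Z (2); seat res-L1-w45a-lead-1 g8;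
# scope memo `Cruxes/FInjectiveMacaulayfication/Lines/LEMMA-N-SCOPE.md`)

[OURS · L1 W4.5a] Support file (`--supports stmt-ResolutionOfSingularities-15315 --as helper`); replaces the role of NO printed item; NOT a statement
of any manuscript; def-free, pure linear algebra; AI-written (AI review is weaker than expert review).

WHY: the block `W′ = z·I₈ + N_g` of the coordinate matrix of `F_* A₀` (`A₀ = k[x,y,u,t,z]/(z² + x⁴z + y³+u³+t³)`, char 2) satisfies `W′² = x⁴z·I₈`; Jacobi's
identity turns the LARGE minors (size `k ≥ 5`) of `W′` into `(x⁴z)^{k−4}` times the complementary SMALL minors, so the one-block norm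
`Σ_k x^{−2k} I_k(W′)` collapses to `x⁻⁸·(x⁸ + x⁶I₁ + x⁴I₂ + x²I₃ + I₄)` and only minors of size `≤ 4` ever have to be computed in the kernel.

* §1 `det_toBlocks₁₁_eq_det_mul_det_toBlocks₂₂` — for block matrices `M N : Matrix (m ⊕ n) (m ⊕ n) R` with `M * N = 1`:
  `det M₁₁ = det M * det N₂₂` (from `M · [[1, N₁₂],[0, N₂₂]] = [[M₁₁, 0],[M₂₁, 1]]`).
* §2 `det_submatrix_eq_sign_mul_det_mul_det_submatrix_compl` — the same for an arbitrary square `W` with a right inverse `V` and arbitrary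
  row/column partitions `e e′ : ι ≃ m ⊕ n`: `det W_{T,C} = sign · det W · det V_{Cᶜ,Tᶜ}`.
* §3 `pow_mul_det_submatrix_of_mul_self` — over a DOMAIN, if `W * W = c • 1` with `c ≠ 0` then
  `c ^ |n| · det W_{T,C} = sign · det W · det W_{Cᶜ,Tᶜ}` (`V := c⁻¹ W` over the fraction field, denominators cleared).
[folklore (Jacobi 1841); no Mathlib statement of the complementary-minor identity exists at this date]
-/

-- single-problem summit: the doubled namespace component is forced
set_option linter.dupNamespace false

namespace Summit.ResolutionOfSingularities.ResolutionOfSingularities.Theorems.FInjectiveMacaulayfication.JacobiMinor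

open Matrix

variable {R : Type*} [CommRing R]
variable {m n : Type*} [Fintype m] [Fintype n] [DecidableEq m] [DecidableEq n]

/-! ## §1 Block form -/

/-- **Jacobi, block form**: if `M * N = 1` for block matrices over `m ⊕ n`, then `det M₁₁ = det M * det N₂₂`.
Proof: `M · [[1, N₁₂],[0, N₂₂]] = [[M₁₁, 0],[M₂₁, 1]]` by the `(1,2)` and `(2,2)` block equations of `M N = 1`, and both products have
block-triangular determinants. [folklore] -/
theorem det_toBlocks₁₁_eq_det_mul_det_toBlocks₂₂ (M N : Matrix (m ⊕ n) (m ⊕ n) R) (h : M * N = 1) :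
    M.toBlocks₁₁.det = M.det * N.toBlocks₂₂.det := by
  have hM := M.fromBlocks_toBlocks
  have hN := N.fromBlocks_toBlocks
  have hprod : fromBlocks M.toBlocks₁₁ M.toBlocks₁₂ M.toBlocks₂₁ M.toBlocks₂₂ *
      fromBlocks N.toBlocks₁₁ N.toBlocks₁₂ N.toBlocks₂₁ N.toBlocks₂₂ = fromBlocks 1 0 0 1 := by
    rw [hM, hN, h, fromBlocks_one]
  rw [fromBlocks_multiply, fromBlocks_inj] at hprod
  obtain ⟨-, h12, -, h22⟩ := hprod
  have key : M * fromBlocks (1 : Matrix m m R) N.toBlocks₁₂ 0 N.toBlocks₂₂ =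
      fromBlocks M.toBlocks₁₁ 0 M.toBlocks₂₁ (1 : Matrix n n R) := by
    conv_lhs => rw [← hM]
    rw [fromBlocks_multiply, Matrix.mul_one, Matrix.mul_zero, add_zero, Matrix.mul_one, Matrix.mul_zero, add_zero, h12, h22]
  have hdet := congrArg det key
  rw [det_mul, det_fromBlocks_zero₂₁, det_fromBlocks_zero₁₂, det_one, one_mul, det_one, mul_one] at hdet
  exact hdet.symm

/-! ## §2 Arbitrary row and column partitions -/

variable {ι : Type*} [Fintype ι] [DecidableEq ι]

/-- **Jacobi's complementary-minor identity**: for a square matrix `W` with right inverse `V` (`W * V = 1`) and partitions of the row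
and column index type `e e′ : ι ≃ m ⊕ n` (so `T := e⁻¹(inl m)` are the chosen rows and `C := e′⁻¹(inl m)` the chosen columns),
`det W_{T,C} = sign(e′⁻¹ ≫ e) · det W · det V_{Cᶜ,Tᶜ}`. [folklore (Jacobi)] -/
theorem det_submatrix_eq_sign_mul_det_mul_det_submatrix_compl (W V : Matrix ι ι R) (h : W * V = 1) (e e' : ι ≃ m ⊕ n) :
    (W.submatrix (e.symm ∘ Sum.inl) (e'.symm ∘ Sum.inl)).det =
      Equiv.Perm.sign (e'.symm.trans e) * W.det * (V.submatrix (e'.symm ∘ Sum.inr) (e.symm ∘ Sum.inr)).det := by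
  have h1 : W.submatrix e.symm e'.symm * V.submatrix e'.symm e.symm = 1 := by
    rw [submatrix_mul_equiv, h, submatrix_one_equiv]
  have hJ := det_toBlocks₁₁_eq_det_mul_det_toBlocks₂₂ _ _ h1
  have hb1 : (W.submatrix e.symm e'.symm).toBlocks₁₁ = W.submatrix (e.symm ∘ Sum.inl) (e'.symm ∘ Sum.inl) := by
    ext i j; rfl
  have hb2 : (V.submatrix e'.symm e.symm).toBlocks₂₂ = V.submatrix (e'.symm ∘ Sum.inr) (e.symm ∘ Sum.inr) := by
    ext i j; rfl
  have hdet : (W.submatrix e.symm e'.symm).det = Equiv.Perm.sign (e'.symm.trans e) * W.det := by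
    have hre : W.submatrix e.symm e'.symm = (W.submatrix e.symm e.symm).submatrix id (e'.symm.trans e) := by
      ext i j
      simp only [submatrix_apply, id_eq, Equiv.trans_apply, Equiv.symm_apply_apply]
    rw [hre, det_permute', det_submatrix_equiv_self]
  rw [hb1, hb2, hdet] at hJ
  exact hJ

/-! ## §3 Matrices with `W * W = c • 1` over a domain -/

/-- **Duality of minors for `W² = c·1`** (`c ≠ 0`, `R` a domain): `c ^ |n| · det W_{T,C} = sign · det W · det W_{Cᶜ,Tᶜ}` — Jacobi's identity for the
right inverse `V = c⁻¹·W` over the fraction field, denominators cleared. With `det W = c^{|ι|/2}` this reads «a `k`-minor is `± c^{k − |ι|/2}` times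
its complementary `(|ι| − k)`-minor». [folklore] -/
theorem pow_mul_det_submatrix_of_mul_self [IsDomain R] (W : Matrix ι ι R) (c : R) (hc : c ≠ 0)
    (hW : W * W = c • (1 : Matrix ι ι R)) (e e' : ι ≃ m ⊕ n) :
    c ^ Fintype.card n * (W.submatrix (e.symm ∘ Sum.inl) (e'.symm ∘ Sum.inl)).det =
      Equiv.Perm.sign (e'.symm.trans e) * W.det * (W.submatrix (e'.symm ∘ Sum.inr) (e.symm ∘ Sum.inr)).det := by
  classical
  let K := FractionRing R
  let φ : R →+* K := algebraMap R K
  have hinj : Function.Injective φ := IsFractionRing.injective R K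
  have hφc : φ c ≠ 0 := (map_ne_zero_iff φ hinj).mpr hc
  -- pass to `K`
  let WK : Matrix ι ι K := W.map φ
  have hsmul : (c • (1 : Matrix ι ι R)).map φ = φ c • (1 : Matrix ι ι K) := by
    ext i j
    by_cases hij : i = j
    · subst hij; simp
    · simp [Matrix.one_apply_ne hij]
  have hWK : WK * WK = φ c • (1 : Matrix ι ι K) := by
    have := congrArg (fun M : Matrix ι ι R => M.map φ) hW
    simp only [Matrix.map_mul] at this
    rw [hsmul] at this
    exact this
  -- the right inverse `V = (φ c)⁻¹ • WK`
  let V : Matrix ι ι K := (φ c)⁻¹ • WK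
  have hV : WK * V = 1 := by
    simp only [V, Matrix.mul_smul, hWK, smul_smul, inv_mul_cancel₀ hφc, one_smul]
  have J := det_submatrix_eq_sign_mul_det_mul_det_submatrix_compl WK V hV e e'
  have hVsub : V.submatrix (e'.symm ∘ Sum.inr) (e.symm ∘ Sum.inr) =
      (φ c)⁻¹ • WK.submatrix (e'.symm ∘ Sum.inr) (e.symm ∘ Sum.inr) := rfl
  rw [hVsub, det_smul] at J
  -- clear the denominator `(φ c)^|n|`
  have hcn : (φ c) ^ Fintype.card n ≠ 0 := pow_ne_zero _ hφc
  have J' : (φ c) ^ Fintype.card n * (WK.submatrix (e.symm ∘ Sum.inl) (e'.symm ∘ Sum.inl)).det =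
      Equiv.Perm.sign (e'.symm.trans e) * WK.det * (WK.submatrix (e'.symm ∘ Sum.inr) (e.symm ∘ Sum.inr)).det := by
    rw [J]
    have h' : (φ c) ^ Fintype.card n * (φ c)⁻¹ ^ Fintype.card n = 1 := by
      rw [inv_pow, mul_inv_cancel₀ hcn]
    linear_combination ((Equiv.Perm.sign (e'.symm.trans e) : ℤ) : K) * WK.det *
      (WK.submatrix (e'.symm ∘ Sum.inr) (e.symm ∘ Sum.inr)).det * h'
  -- read back in `R`
  apply hinj
  have hsub1 : WK.submatrix (e.symm ∘ Sum.inl) (e'.symm ∘ Sum.inl) = (W.submatrix (e.symm ∘ Sum.inl) (e'.symm ∘ Sum.inl)).map φ := rfl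
  have hsub2 : WK.submatrix (e'.symm ∘ Sum.inr) (e.symm ∘ Sum.inr) = (W.submatrix (e'.symm ∘ Sum.inr) (e.symm ∘ Sum.inr)).map φ := rfl
  rw [hsub1, hsub2] at J'
  simp only [map_mul, map_pow, map_intCast, RingHom.map_det, RingHom.mapMatrix_apply]
  simpa only [WK, RingHom.map_det, RingHom.mapMatrix_apply] using J'

end Summit.ResolutionOfSingularities.ResolutionOfSingularities.Theorems.FInjectiveMacaulayfication.JacobiMinor
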